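import Summits.QuantumFields.YangMills.Theorems.UnitScaleTiltHalvingP1FlatCoreFamilyDoor
import HarnessLib

/-!
# Route `UnitScaleTilt`, crux K1 child «MinimiserStabilityRegPr» (stmt-QuantumFields-19200), registered stub V2′ `stub_halvingStep` (v10 `BirthV10`) —
# **(A-1) STAGE 4: THE CONSTANTS WRAPPER — the H door's ONE displayed hypothesis `hP1room` (✓`HalvingStubOfHP1Room.stub_halvingStep_of_hP1room`) VERBATIM
# from the UNIFORM SUPPLIER BINDER `hSupU`** = `hP1room`'s own outer prefix with `∃ Nr` replaced by N05's member size `∃ M′ ≥ 1`, the room premise spelled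
# `2ρ + (M′ + 1 + 2(M + L + S)) ≤ L^{m+n}`, and body = the family door's per-site `hSup` ∃-block at `(M′, ρ′ := ρ + M + L + S, B₁)`

Cell `ym3-torus` (HUMAN RULING D-0037, YM ladder rung R3 — continuum SU(2) YM₃ on the three-torus is a RUNG, NOT the Clay problem), width seat `ym-ust-19200-w3` gen 6
(H-door lineage; LEAD-H ★w5-19200 g4 «H = hP1room» BOARD v1 ∕ RULING L-9; (A-1) owner ★w3-20520 g5's STAGE 4 shape (bus 14:03:21Z), pen handed to this seat; tag worded
by the OWNER: `--supports stmt-QuantumFields-19200 --as helper`).  Definition-free, 0 sorry, standard axioms.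

WHY.  By ★★OWNER RULING g27-№4 ∕ ACK 66 the registered H text follows from ONE displayed hypothesis, `hP1room` (H door of record ✓`stub_halvingStep_of_hP1room`).  The (A-1)
family door ✓`HalvingP1FlatCoreFamilyDoor.p1FlatPillar'_room_of_suppliers` (STAGE 1b) delivers its INNER text (fixed `(L, ρ, S, M, N_r, R′, a, Cr, B₁, M′, ρ′)`) from the
displayed per-site supplier block `hSup`, but still asks for the cube data `R′·M ≤ S`, `2L ≤ R′·M + 1`, `2 ≤ S`, the room split `M′ + 1 + 2ρ′ ≤ 2ρ + N_r`, `M ≤ N_r`, the window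
geometry `2 ≤ ρ′`, `ρ + M ≤ ρ′ + 1`, `L + S + M ≤ ρ′ + 2`, and the extra smallness `10⁷L³a ≤ 1` — none of which is a letter of `hP1room`.  THIS FILE discharges them all by
CHOICES inside `hP1room`'s quantifier prefix: `R′ := R` with the output floor `Rₚ ↦ max Rₚ (2L)` (⇒ `2L ≤ R·M + 1`, `S ≥ 4`); `B₁ ↦ max B₁ 6` (⇒ `10⁷L³a ≤ 1` from the window
`60800·(5L)²·L·(B₁+1)·a ≤ 1`, since `16·3800·25·7 = 1.064·10⁷`; the (iii) size rows weaken monotonically in `B₁` at `ε₀ > 0`; the window is pulled back to the supplier's `B₁`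
by the sign split on `a`); `ρ′ := ρ + M + L + S` (⇒ the three geometry letters); `N_r := M′ + 1 + 2(M + L + S)` (ρ-FREE ⇒ chosen before `∀ ρ` as the prefix demands,
⇒ the room split with equality and `M ≤ N_r`).
* §1 `cubeData_of_prefix`, `window_mono_B₁`, `ha7_of_window` — the arithmetic bricks.
* §2 ★★★ `hP1room_of_suppliers (hSupU) : <hP1room VERBATIM>` — so that `stub_halvingStep_of_hP1room (hP1room_of_suppliers hSupU)` is the registered H text from the ONE
  displayed text `hSupU`, whose body is inhabited row by row by the J programme (N05's k-level output, the top step ✓`P1FlatCoreTopStepTorus.hFP_kLevel_top_RD`, the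
  (P3-top-b) linear knit, the (R4) sizes — STAGE 2∕3, not here).
HONEST SCOPE.  Quantifier∕constants bookkeeping over landed rows; `hSupU` is a HYPOTHESIS.  NOT a claim about [Balaban1985RegularSpaces] Thm 2, the stub, the crux, the
rung or the mass gap; no summit statement is proved by this seat.

References: T. Bałaban, CMP **99** (1985) 75–102 [Balaban1985RegularSpaces] Thm 2 p.83, (1.36)–(1.38) p.82; CMP **102** (1985) 277–309 [Balaban1985Variational]
Prop 2 p.281, (144) p.300, (150)–(156) pp.301–302, (160) p.303.
-/

set_option autoImplicit false

noncomputable section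

open scoped BigOperators Matrix.Norms.L2Operator

namespace Summit.QuantumFields.YangMills.Theorems.HalvingP1FlatPillarRoomOfSuppliers

open Literature.MathematicalPhysics.QuantumFieldTheory.Balaban1983to89
open Literature.MathematicalPhysics.QuantumFieldTheory.Balaban1983to89.T3ContinuumYM3Torus
open Literature.MathematicalPhysics.QuantumFieldTheory.Balaban1983to89.T3PrintedRegularMinimiser
open T4Continuum BlockAveraging ExpMeanLog T3RegularMinimiser
open Complex (I)
open MatrixLog (mlog)
open B5Eq118OneStroke (iterBlockOf)
open B6SectAOperatorsV1 (SiteIdx)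
open B7Prop1Explicit renaming Site → LSite
open B7Prop1Explicit (e)
open B7Prop1Local (InBox)
open B8Eq131Cubes (cube flm gs sqLo sqHi)
open B8Eq138LandauZd (covDivB covLap QT)
open B8CubeMemberZd (cubeLamS)
open B10Eq27TorusAxialLog (transl rel unitsField toUField suIncl gaugeActT axialT)
open B15Eq112TorusCover (lift)
open Node00 (coverAt)
open LatticeFieldCalculus (laplace diverg siteAvgIter)
open FlatCubeOpsText (IsLevWeight)
open FlatCubeSequenceAligned (cubeSeqMT3 cubeSetM)
open Summit.QuantumFields.YangMills.Theorems.Prop8ChartDoubleBar (dbarIterU vframeU)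
open HalvingP1FlatPillar (DP1Clause)
open HalvingP1FlatPillarPrime (P1FlatPillarAt')
open HalvingP1FlatCoreExtractionMult (p1FlatPillar'_room_of_mlogChartDataMult)
open HalvingP1FlatCoreChartDataDoor (mlogChartDataMult_of_suppliers_cubeLamS)
open P1FlatCoreCubeInclusion (corner_of_offset room_of_level_k)
open P1FlatCoreDP1Target (sitesPerDir_top_eq)
open HalvingP1FlatCoreFamilyDoor (p1FlatPillar'_room_of_suppliers)

/-! ## §1 The arithmetic of the choices -/

/-- The cube data at `R′ := R` from the prefix letters: `1 < L`, `1 ≤ M`, `2L ≤ R` (output floor `max Rₚ (2L) ≤ R`), `R·M ≤ S` give `2L ≤ R·M + 1` and `2 ≤ S`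
(indeed `S ≥ 4`). [folklore] -/
theorem cubeData_of_prefix {L R M S : ℕ} (hL : 1 < L) (hM : 1 ≤ M) (h2L : 2 * L ≤ R) (hRS : R * M ≤ S) :
    2 * L ≤ R * M + 1 ∧ 2 ≤ S := by
  have hRM1 : R * 1 ≤ R * M := Nat.mul_le_mul_left R hM
  rw [mul_one] at hRM1
  constructor <;> omega

/-- The P1 window `60800·(5L)²·L·(B₁+1)·a ≤ 1` pulls back from a larger `B₁′` to a smaller `B₁ ≥ 0` (monotone for `a ≥ 0`; for `a < 0` its left side is `≤ 0`).
[folklore] -/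
theorem window_mono_B₁ {L : ℕ} {B₁ B₁' a : ℝ} (hB₁ : 0 ≤ B₁) (hle : B₁ ≤ B₁')
    (h : 16 * 3800 * ((5 * L : ℕ) : ℝ) ^ 2 * (L : ℝ) * ((B₁' + 1) * a) ≤ 1) :
    16 * 3800 * ((5 * L : ℕ) : ℝ) ^ 2 * (L : ℝ) * ((B₁ + 1) * a) ≤ 1 := by
  have hc : 0 ≤ 16 * 3800 * ((5 * L : ℕ) : ℝ) ^ 2 * (L : ℝ) := by positivity
  rcases le_or_gt 0 a with ha | ha
  · have h1 : (B₁ + 1) * a ≤ (B₁' + 1) * a := mul_le_mul_of_nonneg_right (by linarith) ha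
    exact (mul_le_mul_of_nonneg_left h1 hc).trans h
  · have h1 : (B₁ + 1) * a ≤ 0 := mul_nonpos_of_nonneg_of_nonpos (by linarith) ha.le
    have h2 : 16 * 3800 * ((5 * L : ℕ) : ℝ) ^ 2 * (L : ℝ) * ((B₁ + 1) * a) ≤ 0 := mul_nonpos_of_nonneg_of_nonpos hc h1
    linarith

/-- The family door's extra smallness `10⁷·L³·a ≤ 1` from the P1 window at `B₁ ≥ 6`: `16·3800·25·7 = 10 640 000 ≥ 10⁷`. [folklore] -/
theorem ha7_of_window {L : ℕ} {B₁ a : ℝ} (h6 : 6 ≤ B₁)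
    (h : 16 * 3800 * ((5 * L : ℕ) : ℝ) ^ 2 * (L : ℝ) * ((B₁ + 1) * a) ≤ 1) :
    10 ^ 7 * (L : ℝ) ^ 3 * a ≤ 1 := by
  have hcast : ((5 * L : ℕ) : ℝ) = 5 * (L : ℝ) := by push_cast; ring
  rw [hcast] at h
  have hL3 : 0 ≤ (L : ℝ) ^ 3 := by positivity
  rcases le_or_gt 0 a with ha | ha
  · have hX : 0 ≤ (L : ℝ) ^ 3 * a := mul_nonneg hL3 ha
    have hkey : 16 * 3800 * (5 * (L : ℝ)) ^ 2 * (L : ℝ) * ((B₁ + 1) * a) = 1520000 * (B₁ + 1) * ((L : ℝ) ^ 3 * a) := by ring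
    rw [hkey] at h
    have h7 : 1520000 * 7 * ((L : ℝ) ^ 3 * a) ≤ 1520000 * (B₁ + 1) * ((L : ℝ) ^ 3 * a) := by nlinarith
    calc 10 ^ 7 * (L : ℝ) ^ 3 * a = 10 ^ 7 * ((L : ℝ) ^ 3 * a) := by ring
      _ ≤ 1520000 * 7 * ((L : ℝ) ^ 3 * a) := by nlinarith
      _ ≤ 1 := h7.trans h
  · have h1 : 0 ≤ 10 ^ 7 * (L : ℝ) ^ 3 := by positivity
    have h2 : 10 ^ 7 * (L : ℝ) ^ 3 * a ≤ 0 := mul_nonpos_of_nonneg_of_nonpos h1 ha.le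
    linarith

/-! ## §2 ★★★ `hP1room` from the uniform supplier binder -/

open Classical in
/-- ★★★ **(A-1) STAGE 4 — THE H DOOR's `hP1room` FROM THE UNIFORM SUPPLIER BINDER `hSupU`.**  `hSupU` = `hP1room`'s own outer prefix
(`∀ L odd > 1, ∃ Mₚ Rₚ, ∀ R M aₑ S (hM), M = L^aₑ → Mₚ ≤ M → Rₚ ≤ R → R·M ≤ S → ∃ B₁ ≥ 0, …`) with `∃ Nr` replaced by `∃ M′ ≥ 1` (N05's member size, fixed before
`∀ ρ`), the room premise `2ρ + (M′ + 1 + 2(M + L + S)) ≤ L^{m+n}`, and body = ✓`HalvingP1FlatCoreFamilyDoor.p1FlatPillar'_room_of_suppliers`'s per-site ∃-block `hSup` VERBATIM at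
`(M′, ρ′ := ρ + M + L + S, B₁)`: an offset `t ∈ [0, M′−1]`, the `ℤ³` gauge `w`, one-form `X`, multiplier `μ` with the chart rows `hWnear`∕`hX` (`η = L^{−k}`) and the flat
Landau window at `cubeLamS`, the top-step frames `g h′ κ′ ν gs′` with recursions, `hug`, `htop`, and the two (1.36)♭ size rows.  CONCLUSION: the `hP1room` binder of
✓`HalvingStubOfHP1Room.stub_halvingStep_of_hP1room` ∕ ✓`HalvingStepOfPillarsRoomStatDoor.halvingStep_of_rows_roomStat₂` ∕ ✓`HalvingStepOfPillarsRoom.roomHalving_of_rows` VERBATIM.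
Choices: `Rₚ ↦ max Rₚ (2L)`, `B₁ ↦ max B₁ 6`, `Nr := M′ + 1 + 2(M + L + S)`, `ρ′ := ρ + M + L + S`, `R′ := R` (§1).
[cite: Balaban1985RegularSpaces, Thm 2 p.83, (1.36)-(1.38) p.82; Balaban1985Variational, Prop 2 p.281, (144) p.300, (150)-(156) pp.301-302, (160) p.303] -/
theorem hP1room_of_suppliers
    (hSupU : ∀ L : ℕ, Odd L → 1 < L → ∃ (Mₚ Rₚ : ℕ), ∀ (R M aₑ S : ℕ) (hM : 1 ≤ M), M = L ^ aₑ → Mₚ ≤ M → Rₚ ≤ R → R * M ≤ S →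
      ∃ B₁ : ℝ, 0 ≤ B₁ ∧ ∃ M' : ℕ, 1 ≤ M' ∧
      ∀ (ρ : ℕ) (a Cr : ℝ), 0 < Cr → 12 * ((ρ : ℝ) + (M : ℝ)) * a ≤ Cr →
        16 * 3800 * ((5 * L : ℕ) : ℝ) ^ 2 * (L : ℝ) * ((B₁ + 1) * a) ≤ 1 →
        ∀ F : T3Family, F.L = L → ∀ (n K : ℕ) (hnK : n < K), 2 * ρ + (M' + 1 + 2 * (M + L + S)) ≤ F.L ^ (F.m + n) →
          ∀ (ε₀ ε₁ : ℝ), 0 < ε₁ → 0 < ε₀ → ε₀ ≤ a → Cr * ε₁ ≤ ε₀ →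
          ∀ V : GaugeField (F.P n) 0 (Matrix.specialUnitaryGroup (Fin 2) ℂ), PlaqSmall ε₁ V →
            ∀ U ∈ regFibrePr F n K hnK.le ε₀ V, ∀ x₀ : Site (F.P K) 0,
              ∃ (t : ℤ) (_ : 0 ≤ t) (_ : t ≤ (M' : ℤ) - 1)
                (w : LSite (F.P K).d → Matrix.specialUnitaryGroup (Fin 2) ℂ) (X : LSite (F.P K).d → Fin (F.P K).d → Matrix (Fin 2) (Fin 2) ℂ)
                (μ : ℕ → LSite (F.P K).d → Matrix (Fin 2) (Fin 2) ℂ)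
                (g h' : GaugeTransf (F.P K) 0 (Matrix (Fin 2) (Fin 2) ℂ)ˣ) (κ' : (i : ℕ) → GaugeTransf (F.P K) i (Matrix (Fin 2) (Fin 2) ℂ)ˣ)
                (ν : (i : ℕ) → Site (F.P K) i → (Matrix (Fin 2) (Fin 2) ℂ)ˣ) (gs' : (i : ℕ) → GaugeTransf (F.P K) i (Matrix (Fin 2) (Fin 2) ℂ)ˣ),
                -- [N05 ∕ J3] chart rows and flat Landau window at the corner `a := Bᵏx₀ − t`
                (∀ z ∈ cube (F.P K).L (fun μ => ((iterBlockOf (K - n) x₀ μ).val : ℤ) - t) M' (ρ + M + L + S) (K - n) 0, ∀ ν : Fin (F.P K).d,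
                  transl (0 : Site (F.P K) 0) z ∈ cubeSetM x₀ (K - n) ρ S M 0 → (transl (0 : Site (F.P K) 0) z).shift ν ∈ cubeSetM x₀ (K - n) ρ S M 0 →
                  ‖(((Unitary.toUnits (suIncl (w z)))⁻¹ * unitsField (toUField U) ⟨transl 0 z, ν⟩ * Unitary.toUnits (suIncl (w (z + e ν))) :
                      (Matrix (Fin 2) (Fin 2) ℂ)ˣ) : Matrix (Fin 2) (Fin 2) ℂ) - 1‖ ≤ 1 / 4) ∧
                (∀ z ∈ cube (F.P K).L (fun μ => ((iterBlockOf (K - n) x₀ μ).val : ℤ) - t) M' (ρ + M + L + S) (K - n) 0, ∀ ν : Fin (F.P K).d,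
                  transl (0 : Site (F.P K) 0) z ∈ cubeSetM x₀ (K - n) ρ S M 0 → (transl (0 : Site (F.P K) 0) z).shift ν ∈ cubeSetM x₀ (K - n) ρ S M 0 →
                  I • ((((F.L : ℝ)⁻¹) ^ (K - n)) • X z ν) = mlog (((Unitary.toUnits (suIncl (w z)))⁻¹ * unitsField (toUField U) ⟨transl 0 z, ν⟩ *
                      Unitary.toUnits (suIncl (w (z + e ν))) : (Matrix (Fin 2) (Fin 2) ℂ)ˣ) : Matrix (Fin 2) (Fin 2) ℂ)) ∧
                (∀ z ∈ cube (F.P K).L (fun μ => ((iterBlockOf (K - n) x₀ μ).val : ℤ) - t) M' (ρ + M + L + S) (K - n) 0,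
                  covLap (((F.L : ℝ)⁻¹) ^ (K - n)) (1 : LSite (F.P K).d → Fin (F.P K).d → (Matrix (Fin 2) (Fin 2) ℂ)ˣ)
                      ((cube (F.P K).L (fun μ => ((iterBlockOf (K - n) x₀ μ).val : ℤ) - t) M' (ρ + M + L + S) (K - n) 0).indicator
                        (covDivB (((F.L : ℝ)⁻¹) ^ (K - n)) (1 : LSite (F.P K).d → Fin (F.P K).d → (Matrix (Fin 2) (Fin 2) ℂ)ˣ) X)) z =
                    QT (F.P K).L (K - n) (cubeLamS (F.P K).L (fun μ => ((iterBlockOf (K - n) x₀ μ).val : ℤ) - t) M' (ρ + M + L + S) (K - n) (K - n))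
                      (1 : LSite (F.P K).d → Fin (F.P K).d → (Matrix (Fin 2) (Fin 2) ℂ)ˣ) μ z) ∧
                -- [top step] frames, composite gauge, top identity
                κ' 0 = h' ∧
                (∀ (i : ℕ) (y : Site (F.P K) (i + 1)),
                  κ' (i + 1) y = (vframeU (gaugeActT (κ' i) (dbarIterU i (gaugeActT g (unitsField (toUField U))))) y)⁻¹ * κ' i (emb y) *
                    vframeU (dbarIterU i (gaugeActT g (unitsField (toUField U)))) y) ∧
                (∀ s, ν 0 s = 1) ∧
                (∀ (i : ℕ) (y : Site (F.P K) (i + 1)), ν (i + 1) y = ν i (emb y) * vframeU (dbarIterU i (gaugeActT g (unitsField (toUField U)))) y) ∧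
                gs' 0 = g ∧ (∀ (i : ℕ) (y : Site (F.P K) (i + 1)), gs' (i + 1) y = gs' i (emb y)) ∧
                (∀ s, (Unitary.toUnits (suIncl (w (lift (F.P K) x₀ + rel x₀ s))))⁻¹ =
                  ((gs' (K - n) (iterBlockOf (K - n) x₀))⁻¹ * ν (K - n) (iterBlockOf (K - n) x₀)) * h' s * g s) ∧
                (∀ yc ∈ cubeLamS (F.P K).L (fun μ => ((iterBlockOf (K - n) x₀ μ).val : ℤ) - t) M' (ρ + M + L + S) (K - n) (K - n) (K - n),
                  κ' (K - n) (coverAt (F.P K) (K - n) yc) =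
                    axialT (dbarIterU (K - n) (gaugeActT g (unitsField (toUField U)))) (iterBlockOf (K - n) x₀) (coverAt (F.P K) (K - n) yc)) ∧
                -- [sizes] the two (1.36)♭ rows of `A := X ∘ rep`
                (∀ wt : ℕ → PBond (F.P K) 0 → ℝ, IsLevWeight F n K (cubeSeqMT3 F n K x₀ ρ S M hM) wt →
                  (∀ b : PBond (F.P K) 0, wt 1 b *
                    ‖(fun b : PBond (F.P K) 0 => if b.src ∈ cubeSetM x₀ (K - n) ρ S M 0 ∧ b.tgt ∈ cubeSetM x₀ (K - n) ρ S M 0 then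
                      X (lift (F.P K) x₀ + rel x₀ b.src) b.dir else 0) b‖ ≤ B₁ * ε₀) ∧
                  (∀ (b : PBond (F.P K) 0) (ν' : Fin (F.P K).d), wt 2 b * (F.L : ℝ) ^ (K - n) *
                    ‖(fun b : PBond (F.P K) 0 => if b.src ∈ cubeSetM x₀ (K - n) ρ S M 0 ∧ b.tgt ∈ cubeSetM x₀ (K - n) ρ S M 0 then
                        X (lift (F.P K) x₀ + rel x₀ b.src) b.dir else 0) ⟨b.src.shift ν', b.dir⟩ -
                      (fun b : PBond (F.P K) 0 => if b.src ∈ cubeSetM x₀ (K - n) ρ S M 0 ∧ b.tgt ∈ cubeSetM x₀ (K - n) ρ S M 0 then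
                        X (lift (F.P K) x₀ + rel x₀ b.src) b.dir else 0) b‖ ≤ B₁ * ε₀))) :
    ∀ L : ℕ, Odd L → 1 < L → ∃ (Mₚ Rₚ : ℕ), ∀ (R M aₑ S : ℕ) (hM : 1 ≤ M), M = L ^ aₑ → Mₚ ≤ M → Rₚ ≤ R → R * M ≤ S →
      ∃ B₁ : ℝ, 0 ≤ B₁ ∧ ∃ Nr : ℕ,
      ∀ (ρ : ℕ) (a Cr : ℝ), 0 < Cr → 12 * ((ρ : ℝ) + (M : ℝ)) * a ≤ Cr →
        16 * 3800 * ((5 * L : ℕ) : ℝ) ^ 2 * (L : ℝ) * ((B₁ + 1) * a) ≤ 1 →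
        ∀ F : T3Family, F.L = L → ∀ (n K : ℕ) (hnK : n < K), 2 * ρ + Nr ≤ F.L ^ (F.m + n) →
          ∀ (ε₀ ε₁ : ℝ), 0 < ε₁ → 0 < ε₀ → ε₀ ≤ a → Cr * ε₁ ≤ ε₀ →
          ∀ V : GaugeField (F.P n) 0 (Matrix.specialUnitaryGroup (Fin 2) ℂ), PlaqSmall ε₁ V →
            ∀ U ∈ regFibrePr F n K hnK.le ε₀ V, ∀ x : Site (F.P K) 0,
              P1FlatPillarAt' F n K (cubeSeqMT3 F n K x ρ S M hM) (cubeSetM x (K - n) ρ S M 0) x ε₀ ε₁ B₁ 6 (8 * (L : ℝ) * (B₁ + 1)) U := by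
  intro L hodd hL
  obtain ⟨Mₚ, Rₚ, h⟩ := hSupU L hodd hL
  refine ⟨Mₚ, max Rₚ (2 * L), fun R M aₑ S hM hMe hMₚ hRₚ hRS => ?_⟩
  have hR : Rₚ ≤ R := le_trans (le_max_left _ _) hRₚ
  have h2L : 2 * L ≤ R := le_trans (le_max_right _ _) hRₚ
  obtain ⟨B₁, hB₁, M', _hM', hbody⟩ := h R M aₑ S hM hMe hMₚ hR hRS
  obtain ⟨hRM, hS⟩ := cubeData_of_prefix hL hM h2L hRS
  refine ⟨max B₁ 6, hB₁.trans (le_max_left _ _), M' + 1 + 2 * (M + L + S), fun ρ a Cr hCr hreg₁ hreg₀ => ?_⟩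
  have h6 : (6 : ℝ) ≤ max B₁ 6 := le_max_right _ _
  have hB₁' : 0 ≤ max B₁ 6 + 1 := by linarith
  have ha7 : 10 ^ 7 * (L : ℝ) ^ 3 * a ≤ 1 := ha7_of_window h6 hreg₀
  have hreg₀' : 16 * 3800 * ((5 * L : ℕ) : ℝ) ^ 2 * (L : ℝ) * ((B₁ + 1) * a) ≤ 1 := window_mono_B₁ hB₁ (le_max_left _ _) hreg₀
  have hNr : M ≤ M' + 1 + 2 * (M + L + S) := by omega
  have hρ' : 2 ≤ ρ + M + L + S := by omega
  have h0 : ρ + M ≤ ρ + M + L + S + 1 := by omega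
  have h1 : L + S + M ≤ ρ + M + L + S + 2 := by omega
  have hNrW : M' + 1 + 2 * (ρ + M + L + S) ≤ 2 * ρ + (M' + 1 + 2 * (M + L + S)) := by omega
  refine p1FlatPillar'_room_of_suppliers L ρ S M (M' + 1 + 2 * (M + L + S)) hM hRS hRM hS hNr hCr hreg₁ hreg₀ hB₁' ha7
    M' (ρ + M + L + S) hρ' h0 h1 hNrW fun F hF n K hnK hroom ε₀ ε₁ hε₁ hε₀ hε₀a hCrε V hV U hU x₀ => ?_
  obtain ⟨t, ht0, ht, w, X, μ, g, h', κ', ν, gs', hWnear, hX, hLan, h0', hs', hν0, hνs, hg0, hgs, hug, htop, hsize⟩ :=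
    hbody ρ a Cr hCr hreg₁ hreg₀' F hF n K hnK hroom ε₀ ε₁ hε₁ hε₀ hε₀a hCrε V hV U hU x₀
  refine ⟨t, ht0, ht, w, X, μ, g, h', κ', ν, gs', hWnear, hX, hLan, h0', hs', hν0, hνs, hg0, hgs, hug, htop, fun wt hwt => ⟨fun b => ?_, fun b ν' => ?_⟩⟩
  · exact ((hsize wt hwt).1 b).trans (mul_le_mul_of_nonneg_right (le_max_left _ _) hε₀.le)
  · exact ((hsize wt hwt).2 b ν').trans (mul_le_mul_of_nonneg_right (le_max_left _ _) hε₀.le)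

end Summit.QuantumFields.YangMills.Theorems.HalvingP1FlatPillarRoomOfSuppliers

end
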